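import Literature.Geometry.Lorentzian.WeakSolutionRegularity
import Literature.Geometry.Riemannian.CompositeChartIntegral
import HarnessLib

/-!
# The Dirichlet integrand `h⁻¹(da, db)` in composite coordinates `Ψ ∘ φ`

Topic `Geometry/Riemannian`. Theorem file (no definitions, no named facts; everything proved).
Companion of `CompositeChartIntegral.lean`: for a smooth Riemannian metric `h` on a manifold `M`
modelled on `ℝᵐ`, an extended chart `φ = extChartAt (𝓡 m) x` and a partial homeomorphism `Ψ` of
`ℝᵐ` with `Ψ.source ⊆ φ.target`, `C^∞` with `C^∞` inverse, the inverse metric reads, at the point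
`p = φ⁻¹(Ψ⁻¹ w)` over `w ∈ Ψ.target` and for functions `a, b` differentiable at `p`,

`h⁻¹(da, db)(p) = ∑ᵢⱼ hⁱʲ(y) ∂_{vᵢ} ã(w) ∂_{vⱼ} b̃(w) = ⟪M(w) ∇ã(w), ∇b̃(w)⟫`,

`y = Ψ⁻¹ w`, `ã = a ∘ φ⁻¹ ∘ Ψ⁻¹`, `vᵢ = DΨ(y) eᵢ`, `(hⁱʲ) = (h_{ij})⁻¹` the inverse chart Gram
matrix (`chartGramMatrix`), and `M(w) = ∑ᵢⱼ hⁱʲ(y) ⟪vᵢ, ·⟫ vⱼ` (O'Neill 1983, Ch. 3, p. 60 and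
Def. 3.50: `g⁻¹(du,dv) = gⁱʲ ∂ᵢu ∂ⱼv`, written in the frame pushed forward by `Ψ`). We prove the
identity and the properties of the coefficient field `M` needed to read a weak equation on `M` as a
uniformly elliptic divergence-form equation on `Ψ.target`:

* `innerDual_mvfderiv_compositeChart_sum`, `innerDual_mvfderiv_compositeChart` — the identity;
* `contDiffOn_compositeCoeff` — `M` is `C^∞` on `Ψ.target`;
* `compositeCoeff_inner_symm`, `compositeCoeff_inner_self_pos` — symmetry and positivity;
* `exists_compositeCoeff_bounds` — `λ ‖ξ‖² ≤ ⟪M(w) ξ, ξ⟫` and `‖M(w)‖ ≤ Λ` on compact parts of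
  `Ψ.target`; `exists_gradSq_compositeChart_bounds` — the two-sided comparison of `h⁻¹(da, da)`
  with `‖∇ã‖²` there.

## References

* B. O'Neill, *Semi-Riemannian Geometry* (1983), Ch. 3, p. 60, Def. 3.50. [ONeill1983]
* E. Hebey, *Nonlinear Analysis on Manifolds* (1999), §2.2 (uniform equivalence in charts).
-/

noncomputable section

open Set Function Filter TopologicalSpace Manifold Bundle Module InnerProductSpace
open scoped Manifold ContDiff Topology Matrix RealInnerProductSpace

namespace Literature.Geometry.Riemannian

open Lorentzian PseudoRiemannianMetric

variable {m : ℕ} {M : Type*} [TopologicalSpace M] [ChartedSpace (EuclideanSpace ℝ (Fin m)) M]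
  [IsManifold (𝓡 m) ∞ M]

/-! ### Differentiability of chart representatives at arbitrary points of the chart domain -/

section Representatives

/-- A function differentiable (in the manifold sense) at a point `p` of the domain of the extended
chart `φ` at `x` has a representative `a ∘ φ⁻¹` differentiable at `φ p`. [folklore] -/
theorem differentiableAt_comp_extChartAt_symm_of_mem (x : M) {a : M → ℝ} {p : M}
    (hp : p ∈ (extChartAt (𝓡 m) x).source) (ha : MDifferentiableAt (𝓡 m) 𝓘(ℝ, ℝ) a p) :
    DifferentiableAt ℝ (a ∘ (extChartAt (𝓡 m) x).symm) (extChartAt (𝓡 m) x p) := by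
  have hp' : p ∈ (chartAt (EuclideanSpace ℝ (Fin m)) x).source := by rwa [extChartAt_source] at hp
  have h2 := ((mdifferentiableAt_iff_of_mem_source (I := 𝓡 m) (I' := 𝓘(ℝ, ℝ)) hp'
    (y := a p) (by simp)).1 ha).2
  simp only [extChartAt_model_space_eq_id, PartialEquiv.refl_coe, Function.id_comp,
    ModelWithCorners.Boundaryless.range_eq_univ, differentiableWithinAt_univ] at h2
  exact h2

/-- The composite representative `ã = a ∘ φ⁻¹ ∘ Ψ⁻¹` is differentiable at `w ∈ Ψ.target` when `a`
is differentiable at `φ⁻¹(Ψ⁻¹ w)` and `Ψ⁻¹` at `w`. [folklore] -/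
theorem differentiableAt_compositeRep (x : M) {Ψ : OpenPartialHomeomorph (EuclideanSpace ℝ (Fin m))
    (EuclideanSpace ℝ (Fin m))} (hΨt : Ψ.source ⊆ (extChartAt (𝓡 m) x).target)
    {w : EuclideanSpace ℝ (Fin m)} (hw : w ∈ Ψ.target) (hΨ' : DifferentiableAt ℝ Ψ.symm w)
    {a : M → ℝ} (ha : MDifferentiableAt (𝓡 m) 𝓘(ℝ, ℝ) a ((extChartAt (𝓡 m) x).symm (Ψ.symm w))) :
    DifferentiableAt ℝ (a ∘ (extChartAt (𝓡 m) x).symm ∘ Ψ.symm) w := by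
  have hy : Ψ.symm w ∈ (extChartAt (𝓡 m) x).target := hΨt (Ψ.map_target hw)
  have hp : (extChartAt (𝓡 m) x).symm (Ψ.symm w) ∈ (extChartAt (𝓡 m) x).source :=
    (extChartAt (𝓡 m) x).map_target hy
  have h1 := differentiableAt_comp_extChartAt_symm_of_mem x hp ha
  rw [(extChartAt (𝓡 m) x).right_inv hy] at h1
  exact h1.comp w hΨ'

/-- **Chain rule through the straightening map**: at `y = Ψ⁻¹ w`,
`D(a ∘ φ⁻¹)(y) v = D(ã)(w) (DΨ(y) v)` with `ã = a ∘ φ⁻¹ ∘ Ψ⁻¹`. [folklore] -/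
theorem fderiv_rep_eq_fderiv_compositeRep (x : M) {Ψ : OpenPartialHomeomorph
    (EuclideanSpace ℝ (Fin m)) (EuclideanSpace ℝ (Fin m))}
    (hΨt : Ψ.source ⊆ (extChartAt (𝓡 m) x).target) {w : EuclideanSpace ℝ (Fin m)}
    (hw : w ∈ Ψ.target) (hΨ : DifferentiableAt ℝ Ψ (Ψ.symm w))
    (hΨ' : DifferentiableAt ℝ Ψ.symm w) {a : M → ℝ}
    (ha : MDifferentiableAt (𝓡 m) 𝓘(ℝ, ℝ) a ((extChartAt (𝓡 m) x).symm (Ψ.symm w)))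
    (v : EuclideanSpace ℝ (Fin m)) :
    fderiv ℝ (a ∘ (extChartAt (𝓡 m) x).symm) (Ψ.symm w) v =
      fderiv ℝ (a ∘ (extChartAt (𝓡 m) x).symm ∘ Ψ.symm) w (fderiv ℝ Ψ (Ψ.symm w) v) := by
  set φ := extChartAt (𝓡 m) x with hφ
  have hy : Ψ.symm w ∈ Ψ.source := Ψ.map_target hw
  have hev : (a ∘ φ.symm) =ᶠ[𝓝 (Ψ.symm w)] ((a ∘ φ.symm ∘ Ψ.symm) ∘ Ψ) := by
    filter_upwards [Ψ.open_source.mem_nhds hy] with y' hy'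
    simp only [Function.comp_apply, Ψ.left_inv hy']
  have hÃ := differentiableAt_compositeRep x hΨt hw hΨ' ha
  have hÃ' : DifferentiableAt ℝ (a ∘ φ.symm ∘ Ψ.symm) (Ψ (Ψ.symm w)) := by
    rw [Ψ.right_inv hw]; exact hÃ
  rw [hev.fderiv_eq, fderiv_comp _ hÃ' hΨ, Ψ.right_inv hw]
  rfl

end Representatives

/-! ### The identity -/

section Identity

variable (h : ContMDiffRiemannianMetric (𝓡 m) ∞ (EuclideanSpace ℝ (Fin m)) (TangentSpace (𝓡 m) : M → Type _))
  (x : M)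

/-- **`h⁻¹(da, db)` in composite coordinates, sum form** (O'Neill 1983, Ch. 3, p. 60 / Def. 3.50,
in the frame `vᵢ = DΨ(y) eᵢ`): at `p = φ⁻¹(Ψ⁻¹ w)`, `w ∈ Ψ.target`,
`h⁻¹(da, db)(p) = ∑ᵢⱼ hⁱʲ(Ψ⁻¹ w) · D ã(w)(DΨ eᵢ) · D b̃(w)(DΨ eⱼ)`.
[cite: ONeill1983, Ch. 3, p. 60] -/
theorem innerDual_mvfderiv_compositeChart_sum {Ψ : OpenPartialHomeomorph
    (EuclideanSpace ℝ (Fin m)) (EuclideanSpace ℝ (Fin m))}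
    (hΨt : Ψ.source ⊆ (extChartAt (𝓡 m) x).target) {w : EuclideanSpace ℝ (Fin m)}
    (hw : w ∈ Ψ.target) (hΨ : DifferentiableAt ℝ Ψ (Ψ.symm w))
    (hΨ' : DifferentiableAt ℝ Ψ.symm w) {a b : M → ℝ}
    (ha : MDifferentiableAt (𝓡 m) 𝓘(ℝ, ℝ) a ((extChartAt (𝓡 m) x).symm (Ψ.symm w)))
    (hb : MDifferentiableAt (𝓡 m) 𝓘(ℝ, ℝ) b ((extChartAt (𝓡 m) x).symm (Ψ.symm w))) :
    (ofRiemannian h).innerDual ((extChartAt (𝓡 m) x).symm (Ψ.symm w))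
        (mvfderiv (𝓡 m) a ((extChartAt (𝓡 m) x).symm (Ψ.symm w))).toLinearMap
        (mvfderiv (𝓡 m) b ((extChartAt (𝓡 m) x).symm (Ψ.symm w))).toLinearMap =
      ∑ i, ∑ j, (chartGramMatrix h x (Ψ.symm w))⁻¹ i j *
        fderiv ℝ (a ∘ (extChartAt (𝓡 m) x).symm ∘ Ψ.symm) w
          (fderiv ℝ Ψ (Ψ.symm w) (EuclideanSpace.single i 1)) *
        fderiv ℝ (b ∘ (extChartAt (𝓡 m) x).symm ∘ Ψ.symm) w
          (fderiv ℝ Ψ (Ψ.symm w) (EuclideanSpace.single j 1)) := by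
  classical
  set g := ofRiemannian h with hg
  set φ := extChartAt (𝓡 m) x with hφ
  set b₀ : Module.Basis (Fin m) ℝ (EuclideanSpace ℝ (Fin m)) :=
    (EuclideanSpace.basisFun (Fin m) ℝ).toBasis with hb₀
  have hbi : ∀ i, b₀ i = EuclideanSpace.single i 1 := fun i => by
    rw [hb₀, OrthonormalBasis.coe_toBasis, EuclideanSpace.basisFun_apply]
  set y := Ψ.symm w with hy_def
  have hy : y ∈ φ.target := hΨt (Ψ.map_target hw)
  have hsrc : φ.symm y ∈ (chartAt (EuclideanSpace ℝ (Fin m)) x).source := by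
    rw [← extChartAt_source (𝓡 m)]
    exact φ.map_target hy
  have h1 := innerDual_mvfderiv_eq_sum_localFrame g b₀ hsrc ha hb
    (uh := a ∘ φ.symm) (vh := b ∘ φ.symm) Filter.EventuallyEq.rfl Filter.EventuallyEq.rfl
  rw [φ.right_inv hy] at h1
  rw [h1]
  refine Finset.sum_congr rfl fun i _ => Finset.sum_congr rfl fun j _ => ?_
  have hGij : (Matrix.of fun i j => g.val (φ.symm y)
      ((trivializationAt (EuclideanSpace ℝ (Fin m)) (TangentSpace (𝓡 m)) x).localFrame b₀ i (φ.symm y))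
      ((trivializationAt (EuclideanSpace ℝ (Fin m)) (TangentSpace (𝓡 m)) x).localFrame b₀ j (φ.symm y))) =
      chartGramMatrix h x y := by
    ext i' j'
    rw [Matrix.of_apply, chartGramMatrix_apply_eq_val_localFrame h x hy]
  rw [hGij, hbi, hbi, fderiv_rep_eq_fderiv_compositeRep x hΨt hw hΨ hΨ' ha,
    fderiv_rep_eq_fderiv_compositeRep x hΨt hw hΨ hΨ' hb]

/-- The inner form of a sum of rank-one operators: for coefficients `c i j` and vectors `v i`,
`⟪(∑ᵢⱼ c i j • ⟪v i, ·⟫ v j) ξ, η⟫ = ∑ᵢⱼ c i j ⟪v i, ξ⟫ ⟪v j, η⟫`. [folklore] -/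
theorem inner_sum_smulRight_apply {ι : Type*} [Fintype ι] (c : ι → ι → ℝ)
    (v : ι → EuclideanSpace ℝ (Fin m)) (ξ η : EuclideanSpace ℝ (Fin m)) :
    ⟪(∑ i, ∑ j, c i j • (innerSL ℝ (v i)).smulRight (v j)) ξ, η⟫ =
      ∑ i, ∑ j, c i j * ⟪v i, ξ⟫ * ⟪v j, η⟫ := by
  simp only [FunLike.coe_sum, Finset.sum_apply, FunLike.coe_smul, Pi.smul_apply,
    ContinuousLinearMap.smulRight_apply, innerSL_apply_apply, sum_inner, real_inner_smul_left]
  refine Finset.sum_congr rfl fun i _ => Finset.sum_congr rfl fun j _ => ?_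
  ring

/-- **`h⁻¹(da, db)` in composite coordinates, operator form**: at `p = φ⁻¹(Ψ⁻¹ w)`,
`h⁻¹(da, db)(p) = ⟪M(w) ∇ã(w), ∇b̃(w)⟫` with
`M(w) = ∑ᵢⱼ hⁱʲ(Ψ⁻¹ w) • ⟪DΨ eᵢ, ·⟫ DΨ eⱼ` (`DΨ` at `Ψ⁻¹ w`) and `∇` the Euclidean gradient.
[cite: ONeill1983, Ch. 3, p. 60] -/
theorem innerDual_mvfderiv_compositeChart {Ψ : OpenPartialHomeomorph
    (EuclideanSpace ℝ (Fin m)) (EuclideanSpace ℝ (Fin m))}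
    (hΨt : Ψ.source ⊆ (extChartAt (𝓡 m) x).target) {w : EuclideanSpace ℝ (Fin m)}
    (hw : w ∈ Ψ.target) (hΨ : DifferentiableAt ℝ Ψ (Ψ.symm w))
    (hΨ' : DifferentiableAt ℝ Ψ.symm w) {a b : M → ℝ}
    (ha : MDifferentiableAt (𝓡 m) 𝓘(ℝ, ℝ) a ((extChartAt (𝓡 m) x).symm (Ψ.symm w)))
    (hb : MDifferentiableAt (𝓡 m) 𝓘(ℝ, ℝ) b ((extChartAt (𝓡 m) x).symm (Ψ.symm w))) :
    (ofRiemannian h).innerDual ((extChartAt (𝓡 m) x).symm (Ψ.symm w))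
        (mvfderiv (𝓡 m) a ((extChartAt (𝓡 m) x).symm (Ψ.symm w))).toLinearMap
        (mvfderiv (𝓡 m) b ((extChartAt (𝓡 m) x).symm (Ψ.symm w))).toLinearMap =
      ⟪(∑ i, ∑ j, (chartGramMatrix h x (Ψ.symm w))⁻¹ i j •
          (innerSL ℝ (fderiv ℝ Ψ (Ψ.symm w) (EuclideanSpace.single i 1))).smulRight
            (fderiv ℝ Ψ (Ψ.symm w) (EuclideanSpace.single j 1)))
        (gradient (a ∘ (extChartAt (𝓡 m) x).symm ∘ Ψ.symm) w),
        gradient (b ∘ (extChartAt (𝓡 m) x).symm ∘ Ψ.symm) w⟫ := by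
  rw [innerDual_mvfderiv_compositeChart_sum h x hΨt hw hΨ hΨ' ha hb, inner_sum_smulRight_apply]
  refine Finset.sum_congr rfl fun i _ => Finset.sum_congr rfl fun j _ => ?_
  have hA := differentiableAt_compositeRep x hΨt hw hΨ' ha
  have hB := differentiableAt_compositeRep x hΨt hw hΨ' hb
  have eA : ∀ v, fderiv ℝ (a ∘ (extChartAt (𝓡 m) x).symm ∘ Ψ.symm) w v =
      ⟪gradient (a ∘ (extChartAt (𝓡 m) x).symm ∘ Ψ.symm) w, v⟫ := fun v => by
    rw [hA.hasGradientAt.hasFDerivAt.fderiv, InnerProductSpace.toDual_apply_apply]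
  have eB : ∀ v, fderiv ℝ (b ∘ (extChartAt (𝓡 m) x).symm ∘ Ψ.symm) w v =
      ⟪gradient (b ∘ (extChartAt (𝓡 m) x).symm ∘ Ψ.symm) w, v⟫ := fun v => by
    rw [hB.hasGradientAt.hasFDerivAt.fderiv, InnerProductSpace.toDual_apply_apply]
  rw [eA, eB, real_inner_comm (gradient (a ∘ (extChartAt (𝓡 m) x).symm ∘ Ψ.symm) w),
    real_inner_comm (gradient (b ∘ (extChartAt (𝓡 m) x).symm ∘ Ψ.symm) w)]

end Identity

/-! ### The coefficient field `M` -/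

section Coefficients

variable
  (h : ContMDiffRiemannianMetric (𝓡 m) ∞ (EuclideanSpace ℝ (Fin m)) (TangentSpace (𝓡 m) : M → Type _))
  (x : M)

/-- **The coefficient field is `C^∞` on `Ψ.target`** (smoothness of the inverse Gram matrix on
the chart target, `contDiffOn_inv_chartGramMatrix_apply`, and of `DΨ ∘ Ψ⁻¹`). [folklore] -/
theorem contDiffOn_compositeCoeff {Ψ : OpenPartialHomeomorph (EuclideanSpace ℝ (Fin m))
    (EuclideanSpace ℝ (Fin m))} (hΨt : Ψ.source ⊆ (extChartAt (𝓡 m) x).target)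
    (hΨ : ContDiffOn ℝ ∞ Ψ Ψ.source) (hΨ' : ContDiffOn ℝ ∞ Ψ.symm Ψ.target) :
    ContDiffOn ℝ ∞ (fun w => ∑ i, ∑ j, (chartGramMatrix h x (Ψ.symm w))⁻¹ i j •
      (innerSL ℝ (fderiv ℝ Ψ (Ψ.symm w) (EuclideanSpace.single i 1))).smulRight
        (fderiv ℝ Ψ (Ψ.symm w) (EuclideanSpace.single j 1))) Ψ.target := by
  have hmaps : MapsTo Ψ.symm Ψ.target Ψ.source := fun w hw => Ψ.map_target hw
  have hcoef : ∀ i j, ContDiffOn ℝ ∞ (fun w => (chartGramMatrix h x (Ψ.symm w))⁻¹ i j) Ψ.target :=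
    fun i j => (contDiffOn_inv_chartGramMatrix_apply h x i j).comp hΨ'
      (fun w hw => hΨt (Ψ.map_target hw))
  have hD : ContDiffOn ℝ ∞ (fun y => fderiv ℝ Ψ y) Ψ.source :=
    hΨ.fderiv_of_isOpen Ψ.open_source le_rfl
  have hv : ∀ i, ContDiffOn ℝ ∞ (fun w => fderiv ℝ Ψ (Ψ.symm w) (EuclideanSpace.single i 1))
      Ψ.target := fun i => (hD.comp hΨ' hmaps).clm_apply contDiffOn_const
  refine ContDiffOn.sum fun i _ => ContDiffOn.sum fun j _ => (hcoef i j).smul ?_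
  have hB : ContDiff ℝ ∞ fun q : (EuclideanSpace ℝ (Fin m) →L[ℝ] ℝ) × EuclideanSpace ℝ (Fin m) =>
      q.1.smulRight q.2 :=
    (ContinuousLinearMap.smulRightL ℝ (EuclideanSpace ℝ (Fin m)) (EuclideanSpace ℝ (Fin m))).isBoundedBilinearMap.contDiff
  have hin : ContDiffOn ℝ ∞ (fun w => innerSL ℝ (fderiv ℝ Ψ (Ψ.symm w) (EuclideanSpace.single i 1)))
      Ψ.target := (innerSL ℝ).contDiff.comp_contDiffOn (hv i)
  exact hB.comp_contDiffOn (hin.prodMk (hv j))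

/-- **The coefficient field is symmetric** (the inverse Gram matrix is). [folklore] -/
theorem compositeCoeff_inner_symm (Ψ : OpenPartialHomeomorph (EuclideanSpace ℝ (Fin m))
    (EuclideanSpace ℝ (Fin m))) (w ξ η : EuclideanSpace ℝ (Fin m)) :
    ⟪(∑ i, ∑ j, (chartGramMatrix h x (Ψ.symm w))⁻¹ i j •
      (innerSL ℝ (fderiv ℝ Ψ (Ψ.symm w) (EuclideanSpace.single i 1))).smulRight
        (fderiv ℝ Ψ (Ψ.symm w) (EuclideanSpace.single j 1))) ξ, η⟫ =
    ⟪ξ, (∑ i, ∑ j, (chartGramMatrix h x (Ψ.symm w))⁻¹ i j •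
      (innerSL ℝ (fderiv ℝ Ψ (Ψ.symm w) (EuclideanSpace.single i 1))).smulRight
        (fderiv ℝ Ψ (Ψ.symm w) (EuclideanSpace.single j 1))) η⟫ := by
  rw [← real_inner_comm ξ, inner_sum_smulRight_apply, inner_sum_smulRight_apply, Finset.sum_comm]
  refine Finset.sum_congr rfl fun j _ => Finset.sum_congr rfl fun i _ => ?_
  have hs : (chartGramMatrix h x (Ψ.symm w))⁻¹ i j = (chartGramMatrix h x (Ψ.symm w))⁻¹ j i := by
    have hsym : (chartGramMatrix h x (Ψ.symm w)).IsSymm :=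
      Matrix.IsSymm.ext fun i j => chartGramMatrix_apply_comm h x _ j i
    exact hsym.inv.apply j i
  rw [hs]; ring

/-- **The coefficient field is positive definite** on `Ψ.target` (`DΨ` is invertible and the
inverse Gram matrix is positive definite, `posDef_chartGramMatrix`). [folklore] -/
theorem compositeCoeff_inner_self_pos
    {Ψ : OpenPartialHomeomorph (EuclideanSpace ℝ (Fin m)) (EuclideanSpace ℝ (Fin m))}
    (hΨt : Ψ.source ⊆ (extChartAt (𝓡 m) x).target) {w : EuclideanSpace ℝ (Fin m)}
    (hw : w ∈ Ψ.target) (hΨ : DifferentiableAt ℝ Ψ (Ψ.symm w))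
    (hΨ' : DifferentiableAt ℝ Ψ.symm w) {ξ : EuclideanSpace ℝ (Fin m)} (hξ : ξ ≠ 0) :
    0 < ⟪(∑ i, ∑ j, (chartGramMatrix h x (Ψ.symm w))⁻¹ i j •
      (innerSL ℝ (fderiv ℝ Ψ (Ψ.symm w) (EuclideanSpace.single i 1))).smulRight
        (fderiv ℝ Ψ (Ψ.symm w) (EuclideanSpace.single j 1))) ξ, ξ⟫ := by
  classical
  rw [inner_sum_smulRight_apply]
  have hy : Ψ.symm w ∈ (extChartAt (𝓡 m) x).target := hΨt (Ψ.map_target hw)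
  have hA : ((chartGramMatrix h x (Ψ.symm w))⁻¹).PosDef := (posDef_chartGramMatrix h x hy).inv
  -- the vector `α = (⟪DΨ eᵢ, ξ⟫)ᵢ` is nonzero
  set α : Fin m → ℝ := fun i => ⟪fderiv ℝ Ψ (Ψ.symm w) (EuclideanSpace.single i 1), ξ⟫ with hα
  have hα0 : α ≠ 0 := by
    intro h0
    -- `DΨ(y)` is surjective (it has the right inverse `D(Ψ⁻¹)(w)`), so `ξ ⊥ range DΨ = E`
    have hcomp : fderiv ℝ Ψ (Ψ.symm w) (fderiv ℝ Ψ.symm w ξ) = ξ := by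
      have := congrArg (fun L : EuclideanSpace ℝ (Fin m) →L[ℝ] EuclideanSpace ℝ (Fin m) => L ξ)
        (fderiv_comp_fderiv_symm hw hΨ hΨ')
      simpa using this
    have hξ' : ⟪fderiv ℝ Ψ (Ψ.symm w) (fderiv ℝ Ψ.symm w ξ), ξ⟫ = 0 := by
      set v := fderiv ℝ Ψ.symm w ξ with hv
      have hexp : fderiv ℝ Ψ (Ψ.symm w) v =
          ∑ i, ⟪EuclideanSpace.single i 1, v⟫ • fderiv ℝ Ψ (Ψ.symm w) (EuclideanSpace.single i 1) := by
        conv_lhs => rw [← (EuclideanSpace.basisFun (Fin m) ℝ).sum_repr' v]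
        simp only [map_sum, map_smul, EuclideanSpace.basisFun_apply]
      rw [hexp, sum_inner]
      refine Finset.sum_eq_zero fun i _ => ?_
      rw [real_inner_smul_left]
      have := congr_fun h0 i
      simp only [hα, Pi.zero_apply] at this
      rw [this, mul_zero]
    rw [hcomp] at hξ'
    exact hξ (inner_self_eq_zero.1 hξ')
  have hpos := hA.dotProduct_mulVec_pos hα0
  rw [star_trivial] at hpos
  have hexp : α ⬝ᵥ ((chartGramMatrix h x (Ψ.symm w))⁻¹ *ᵥ α) =
      ∑ i, ∑ j, (chartGramMatrix h x (Ψ.symm w))⁻¹ i j * α i * α j := by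
    simp only [dotProduct, Matrix.mulVec, Finset.mul_sum]
    refine Finset.sum_congr rfl fun i _ => Finset.sum_congr rfl fun j _ => ?_
    ring
  rw [hexp] at hpos
  exact hpos

/-- **Uniform ellipticity and boundedness of the coefficient field on compact parts of
`Ψ.target`**: there are `0 < λ ≤ Λ` with `λ ‖ξ‖² ≤ ⟪M(w) ξ, ξ⟫` and `‖M(w)‖ ≤ Λ` for `w ∈ K`
(continuity on the compact set `K × 𝕊^{m-1}` and positivity). [folklore] -/
theorem exists_compositeCoeff_bounds {Ψ : OpenPartialHomeomorph (EuclideanSpace ℝ (Fin m))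
    (EuclideanSpace ℝ (Fin m))} (hΨt : Ψ.source ⊆ (extChartAt (𝓡 m) x).target)
    (hΨ : ContDiffOn ℝ ∞ Ψ Ψ.source) (hΨ' : ContDiffOn ℝ ∞ Ψ.symm Ψ.target)
    {K : Set (EuclideanSpace ℝ (Fin m))} (hK : IsCompact K) (hKt : K ⊆ Ψ.target) :
    ∃ lam Lam : ℝ, 0 < lam ∧ lam ≤ Lam ∧ ∀ w ∈ K, ∀ ξ : EuclideanSpace ℝ (Fin m),
      lam * ‖ξ‖ ^ 2 ≤ ⟪(∑ i, ∑ j, (chartGramMatrix h x (Ψ.symm w))⁻¹ i j •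
        (innerSL ℝ (fderiv ℝ Ψ (Ψ.symm w) (EuclideanSpace.single i 1))).smulRight
          (fderiv ℝ Ψ (Ψ.symm w) (EuclideanSpace.single j 1))) ξ, ξ⟫ ∧
      ‖(∑ i, ∑ j, (chartGramMatrix h x (Ψ.symm w))⁻¹ i j •
        (innerSL ℝ (fderiv ℝ Ψ (Ψ.symm w) (EuclideanSpace.single i 1))).smulRight
          (fderiv ℝ Ψ (Ψ.symm w) (EuclideanSpace.single j 1)))‖ ≤ Lam := by
  set Mf : EuclideanSpace ℝ (Fin m) → EuclideanSpace ℝ (Fin m) →L[ℝ] EuclideanSpace ℝ (Fin m) :=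
    fun w => ∑ i, ∑ j, (chartGramMatrix h x (Ψ.symm w))⁻¹ i j •
      (innerSL ℝ (fderiv ℝ Ψ (Ψ.symm w) (EuclideanSpace.single i 1))).smulRight
        (fderiv ℝ Ψ (Ψ.symm w) (EuclideanSpace.single j 1)) with hMf
  have hMc : ContinuousOn Mf Ψ.target := (contDiffOn_compositeCoeff h x hΨt hΨ hΨ').continuousOn
  -- upper bound
  obtain ⟨Lam₀, hLam₀⟩ := hK.exists_bound_of_continuousOn (hMc.mono hKt)
  -- positivity at points of `K`
  have hdΨ : ∀ w ∈ K, DifferentiableAt ℝ Ψ (Ψ.symm w) := fun w hw =>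
    (hΨ.differentiableOn (by simp) _ (Ψ.map_target (hKt hw))).differentiableAt
      (Ψ.open_source.mem_nhds (Ψ.map_target (hKt hw)))
  have hdΨ' : ∀ w ∈ K, DifferentiableAt ℝ Ψ.symm w := fun w hw =>
    (hΨ'.differentiableOn (by simp) w (hKt hw)).differentiableAt (Ψ.open_target.mem_nhds (hKt hw))
  -- the quadratic form on `K × sphere`
  set S : Set (EuclideanSpace ℝ (Fin m) × EuclideanSpace ℝ (Fin m)) :=
    K ×ˢ Metric.sphere (0 : EuclideanSpace ℝ (Fin m)) 1 with hS_def
  have hS : IsCompact S := hK.prod (isCompact_sphere 0 1)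
  set Q : EuclideanSpace ℝ (Fin m) × EuclideanSpace ℝ (Fin m) → ℝ := fun q => ⟪Mf q.1 q.2, q.2⟫
    with hQ_def
  have hQc : ContinuousOn Q S := by
    have h1 : ContinuousOn (fun q : EuclideanSpace ℝ (Fin m) × EuclideanSpace ℝ (Fin m) => Mf q.1) S :=
      hMc.comp continuousOn_fst fun q hq => hKt hq.1
    exact (h1.clm_apply continuousOn_snd).inner continuousOn_snd
  have hQpos : ∀ q ∈ S, 0 < Q q := fun q hq => by
    have hq2 : q.2 ≠ 0 := by
      have : ‖q.2‖ = 1 := mem_sphere_zero_iff_norm.1 hq.2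
      intro h0; rw [h0, norm_zero] at this; exact zero_ne_one this
    exact compositeCoeff_inner_self_pos h x hΨt (hKt hq.1) (hdΨ q.1 hq.1) (hdΨ' q.1 hq.1) hq2
  -- scaling identity
  have hscale : ∀ (w ξ : EuclideanSpace ℝ (Fin m)) (t : ℝ),
      ⟪Mf w (t • ξ), t • ξ⟫ = t * t * ⟪Mf w ξ, ξ⟫ := fun w ξ t => by
    rw [map_smul, real_inner_smul_left, real_inner_smul_right]; ring
  by_cases hne : S.Nonempty
  · obtain ⟨q₀, hq₀, hmin⟩ := hS.exists_isMinOn hne hQc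
    have hlam₀ : 0 < Q q₀ := hQpos q₀ hq₀
    refine ⟨Q q₀, max Lam₀ (Q q₀), hlam₀, le_max_right _ _, fun w hw ξ =>
      ⟨?_, (hLam₀ w hw).trans (le_max_left _ _)⟩⟩
    by_cases hξ : ξ = 0
    · rw [hξ, norm_zero]; simp
    · have ht : 0 < ‖ξ‖ := norm_pos_iff.2 hξ
      set η : EuclideanSpace ℝ (Fin m) := ‖ξ‖⁻¹ • ξ with hη_def
      have hη : ‖η‖ = 1 := by
        rw [hη_def, norm_smul, norm_inv, norm_norm, inv_mul_cancel₀ ht.ne']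
      have hηS : (w, η) ∈ S := ⟨hw, mem_sphere_zero_iff_norm.2 hη⟩
      have hQη : Q q₀ ≤ Q (w, η) := hmin hηS
      have hQη' : Q (w, η) = ‖ξ‖⁻¹ * ‖ξ‖⁻¹ * ⟪Mf w ξ, ξ⟫ := by
        show ⟪Mf w (‖ξ‖⁻¹ • ξ), ‖ξ‖⁻¹ • ξ⟫ = _
        exact hscale w ξ ‖ξ‖⁻¹
      rw [hQη'] at hQη
      have hinv : ‖ξ‖⁻¹ * ‖ξ‖⁻¹ * ‖ξ‖ ^ 2 = 1 := by field_simp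
      calc Q q₀ * ‖ξ‖ ^ 2 ≤ (‖ξ‖⁻¹ * ‖ξ‖⁻¹ * ⟪Mf w ξ, ξ⟫) * ‖ξ‖ ^ 2 :=
            mul_le_mul_of_nonneg_right hQη (sq_nonneg _)
        _ = ⟪Mf w ξ, ξ⟫ := by
            rw [show ‖ξ‖⁻¹ * ‖ξ‖⁻¹ * ⟪Mf w ξ, ξ⟫ * ‖ξ‖ ^ 2 =
              (‖ξ‖⁻¹ * ‖ξ‖⁻¹ * ‖ξ‖ ^ 2) * ⟪Mf w ξ, ξ⟫ by ring, hinv, one_mul]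
  · refine ⟨1, max Lam₀ 1, one_pos, le_max_right _ _, fun w hw ξ =>
      ⟨?_, (hLam₀ w hw).trans (le_max_left _ _)⟩⟩
    by_cases hξ : ξ = 0
    · rw [hξ, norm_zero]; simp
    · exfalso
      have ht : 0 < ‖ξ‖ := norm_pos_iff.2 hξ
      refine hne ⟨(w, ‖ξ‖⁻¹ • ξ), hw, mem_sphere_zero_iff_norm.2 ?_⟩
      rw [norm_smul, norm_inv, norm_norm, inv_mul_cancel₀ ht.ne']

/-- **Two-sided comparison of the Dirichlet integrand with the Euclidean one in composite
coordinates**: on a compact `K ⊆ Ψ.target` there are `0 < λ ≤ Λ` with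
`λ ‖∇ã(w)‖² ≤ h⁻¹(da, da)(φ⁻¹(Ψ⁻¹ w)) ≤ Λ ‖∇ã(w)‖²` for all `w ∈ K` and all `a` differentiable at
`φ⁻¹(Ψ⁻¹ w)` (Hebey 1999, §2.2: uniform equivalence of the metric with the Euclidean one on
coordinate patches). [folklore] -/
theorem exists_gradSq_compositeChart_bounds {Ψ : OpenPartialHomeomorph (EuclideanSpace ℝ (Fin m))
    (EuclideanSpace ℝ (Fin m))} (hΨt : Ψ.source ⊆ (extChartAt (𝓡 m) x).target)
    (hΨ : ContDiffOn ℝ ∞ Ψ Ψ.source) (hΨ' : ContDiffOn ℝ ∞ Ψ.symm Ψ.target)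
    {K : Set (EuclideanSpace ℝ (Fin m))} (hK : IsCompact K) (hKt : K ⊆ Ψ.target) :
    ∃ lam Lam : ℝ, 0 < lam ∧ lam ≤ Lam ∧ ∀ w ∈ K, ∀ a : M → ℝ,
      MDifferentiableAt (𝓡 m) 𝓘(ℝ, ℝ) a ((extChartAt (𝓡 m) x).symm (Ψ.symm w)) →
      lam * ‖gradient (a ∘ (extChartAt (𝓡 m) x).symm ∘ Ψ.symm) w‖ ^ 2 ≤
        (ofRiemannian h).innerDual ((extChartAt (𝓡 m) x).symm (Ψ.symm w))
          (mvfderiv (𝓡 m) a ((extChartAt (𝓡 m) x).symm (Ψ.symm w))).toLinearMap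
          (mvfderiv (𝓡 m) a ((extChartAt (𝓡 m) x).symm (Ψ.symm w))).toLinearMap ∧
      (ofRiemannian h).innerDual ((extChartAt (𝓡 m) x).symm (Ψ.symm w))
          (mvfderiv (𝓡 m) a ((extChartAt (𝓡 m) x).symm (Ψ.symm w))).toLinearMap
          (mvfderiv (𝓡 m) a ((extChartAt (𝓡 m) x).symm (Ψ.symm w))).toLinearMap ≤
        Lam * ‖gradient (a ∘ (extChartAt (𝓡 m) x).symm ∘ Ψ.symm) w‖ ^ 2 := by
  obtain ⟨lam, Lam, hlam, hle, hb⟩ := exists_compositeCoeff_bounds h x hΨt hΨ hΨ' hK hKt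
  have hLam0 : 0 ≤ Lam := hlam.le.trans hle
  refine ⟨lam, Lam, hlam, hle, fun w hw a ha => ?_⟩
  have hdΨ : DifferentiableAt ℝ Ψ (Ψ.symm w) :=
    (hΨ.differentiableOn (by simp) _ (Ψ.map_target (hKt hw))).differentiableAt
      (Ψ.open_source.mem_nhds (Ψ.map_target (hKt hw)))
  have hdΨ' : DifferentiableAt ℝ Ψ.symm w :=
    (hΨ'.differentiableOn (by simp) w (hKt hw)).differentiableAt (Ψ.open_target.mem_nhds (hKt hw))
  rw [innerDual_mvfderiv_compositeChart h x hΨt (hKt hw) hdΨ hdΨ' ha ha]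
  set ξ := gradient (a ∘ (extChartAt (𝓡 m) x).symm ∘ Ψ.symm) w
  obtain ⟨h1, h2⟩ := hb w hw ξ
  refine ⟨h1, ?_⟩
  calc _ ≤ ‖(∑ i, ∑ j, (chartGramMatrix h x (Ψ.symm w))⁻¹ i j •
        (innerSL ℝ (fderiv ℝ Ψ (Ψ.symm w) (EuclideanSpace.single i 1))).smulRight
          (fderiv ℝ Ψ (Ψ.symm w) (EuclideanSpace.single j 1))) ξ‖ * ‖ξ‖ := real_inner_le_norm _ _
    _ ≤ (Lam * ‖ξ‖) * ‖ξ‖ := by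
        refine mul_le_mul_of_nonneg_right ?_ (norm_nonneg _)
        exact (ContinuousLinearMap.le_opNorm _ _).trans (mul_le_mul_of_nonneg_right h2 (norm_nonneg _))
    _ = Lam * ‖ξ‖ ^ 2 := by ring

end Coefficients

end Literature.Geometry.Riemannian

end
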